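import Summits.MatrixMultiplication.MatrixMultiplication.Theses.OctonionicLaser
import Literature.Combinatorics.Additive.TricoloredSumFreeLowerBoundProofs

/-!
# `F2TricoloredCapacity` — the tricolored sum-free capacity of `𝔽₂ⁿ` is at least `3/2^{2/3}`

Support item `stmt-MatrixMultiplication-7935` of route `MatrixMultiplication/OctonionicLaser`:
for every `ε > 0` some `𝔽₂^N` (`N ≥ 1`) contains a tricolored sum-free family
(`Literature.Combinatorics.Additive.IsTricoloredSumFree`) of size `≥ (3/2^{2/3} · 2^{−ε})^N`.

This is pure bookkeeping over the tree's theorem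
`Literature.Combinatorics.Additive.kleinbergSawinSpeyer2018_two` (Kleinberg–Sawin–Speyer 2018,
Theorem 2 at `q = 2`, in `δ`-form: for `0 < δ < 3/2^{2/3}` and all large `n` a tricolored sum-free
family in `(ℤ/2)ⁿ` of size `≥ (3/2^{2/3} − δ)ⁿ`), applied with `δ = 3/2^{2/3} · (1 − 2^{−ε})`.
-/

-- single-problem summit: `Summit.MatrixMultiplication.MatrixMultiplication.…` repeats the name by design (D-0017)
set_option linter.dupNamespace false

namespace Summit.MatrixMultiplication.MatrixMultiplication.Theorems

open Literature.Combinatorics.Additive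

/-- **`F2TricoloredCapacity` holds**: for every `ε > 0` there are `N ≥ 1`, `s`, and a tricolored
sum-free family `x y z : Fin s → (Fin N → ZMod 2)` with `(3/2^{2/3} · 2^{−ε})^N ≤ s`
(Kleinberg–Sawin–Speyer 2018 Thm. 2 at `q = 2`, `θ₂ = 3/2^{2/3}`; Fu–Kleinberg 2014 /
Coppersmith–Winograd for `p = 2`). Proof: `kleinbergSawinSpeyer2018_two` with
`δ = θ₂ (1 − 2^{−ε}) ∈ (0, θ₂)`, so that `θ₂ − δ = θ₂ · 2^{−ε}`, at any admissible `N ≥ 1`. -/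
theorem f2TricoloredCapacity_proof :
    Summit.MatrixMultiplication.MatrixMultiplication.Theses.OctonionicLaser.F2TricoloredCapacity := by
  unfold Summit.MatrixMultiplication.MatrixMultiplication.Theses.OctonionicLaser.F2TricoloredCapacity
  intro ε hε
  set θ : ℝ := 3 / (2:ℝ) ^ ((2:ℝ) / 3) with hθ
  have hθpos : 0 < θ := div_pos (by norm_num) (Real.rpow_pos_of_pos two_pos _)
  have hpow_pos : 0 < (2:ℝ) ^ (-ε) := Real.rpow_pos_of_pos two_pos _
  have hpow_lt_one : (2:ℝ) ^ (-ε) < 1 :=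
    Real.rpow_lt_one_of_one_lt_of_neg (by norm_num) (by linarith)
  set δ : ℝ := θ * (1 - (2:ℝ) ^ (-ε)) with hδ
  have hδpos : 0 < δ := mul_pos hθpos (by linarith)
  have hδlt : δ < θ := by
    have : 0 < θ * (2:ℝ) ^ (-ε) := mul_pos hθpos hpow_pos
    have e : δ = θ - θ * (2:ℝ) ^ (-ε) := by rw [hδ]; ring
    linarith
  obtain ⟨n₀, hn₀⟩ := kleinbergSawinSpeyer2018_two hδpos hδlt
  obtain ⟨s, x, y, z, hfree, hbound⟩ := hn₀ (max n₀ 1) (le_max_left _ _)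
  refine ⟨max n₀ 1, le_max_right _ _, s, x, y, z, hfree, ?_⟩
  have e : θ * (2:ℝ) ^ (-ε) = θ - δ := by rw [hδ]; ring
  rw [e]
  exact hbound

end Summit.MatrixMultiplication.MatrixMultiplication.Theorems
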